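import Summits.BirchSwinnertonDyer.Rank1Residual.X11b.BDPRouteRecordSelmer
import Summits.BirchSwinnertonDyer.Rank1Residual.X11b.LocalTorsionMultiplicative
import HarnessLib

/-!
# Class X11b, route "BDP + converse-theorem engine + Kolyvagin" (p2): the PUB-shaped control input
# is needed only on the sub-shape "split multiplicative at `p` with `p ∣ ord_p Δ_min`" (= (T2α));
# everywhere else on X11b it is ONE Selmer bound (cell `b2b-bsdres`, sub-cell `multr1-p2`, gen 14)

HONEST FRAMING (verbatim, cell `b2b-bsdres`): the goal of the cell is to DELETE the
COMBINATION-SHAPED residual classes for ALL analytic-rank `≤ 1` curves over `ℚ` — "full BSD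
formula for every rank `≤ 1` curve in class `C`" assembled STRICTLY from published theorems — so
that the rank-`≤ 1` remainder becomes exactly the CONSTRUCTION-SHAPED classes, which are TYPED
(missing-input Props), NOT attempted; this is not "finishing BSD". Research route `p2` for class
X11b; no claim beyond the stated class; nothing booked; X11b stays CONSTRUCTION-SHAPED. Theorems
only; no definition, no named fact, no `sorry`.

## Content

`P2.bsdp_of_onTree_weakest_split` (`BDPRouteRecordSelmer`) demands the PUB-shaped control input
`P2ControlUpperOnTreeAt` (Cas18 Thm. 2.3 `≤`) only at the pairs where the erratum's (iv)
`E(ℚ_p)[p] = 0` fails. By the sibling sub-cell's `localTorsion_eq_zero_of_mult` (Silverman VII.2.1,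
VII.3.1, VII.6.1: at a multiplicative `p ≥ 3`, `E(ℚ_p)[p] = 0` unless the reduction is SPLIT and
`p ∣ ord_p Δ_min`), (iv) can only fail on the decidable sub-shape
"`p` split multiplicative ∧ `p ∣ ord_p(Δ_min)`" — the (T2α) sub-shape of this route's map (on which
the Euler-system half has no printed road either; census gen 9: 20 824 class-wide pairs, 777 in the
window `N < 2·10⁴`).

* **`P2.bsdp_of_onTree_weakest_alpha`** — THE STATEMENT OF RECORD with the typed control input
  `P2ControlUpperOnTreeAt` demanded ONLY on X11b ∧ split(p) ∧ `p ∣ ord_p Δ_min`, and ONE Selmer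
  cardinality bound `P2SelmerCardBoundAt` ((d), Cas18 (3.2.1)+(calcul) `≤`) on the pairs with (iv);
  all other inputs as in `P2.bsdp_of_onTree_weakest`. CONDITIONAL; nothing booked; reach, census
  numbers and labels UNCHANGED.

References: [Castella2018] Thm. 2.3, (3.2.1) (arXiv:1704.06608 pp. 5–6); [Castella2018Erratum]
Thm. 1.1 (iv), Thm. A′ and Remark; [SilvermanAEC2009] VII.2.1, VII.3.1, Thm. VII.6.1.
-/

noncomputable section

open scoped Classical

open WeierstrassCurve NumberField IsDedekindDomain Literature.NumberTheory.EllipticCurves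
  Literature.NumberTheory.EllipticCurves.ModularForms
  Literature.NumberTheory.EllipticCurves.Rank1Residual
  Literature.NumberTheory.EllipticCurves.Rank1Residual.Typed
  Literature.NumberTheory.EllipticCurves.Wuthrich2014
  Literature.NumberTheory.EllipticCurves.BalakrishnanEtAl2019
  Literature.NumberTheory.QuadraticFields.Quadratic
  Literature.NumberTheory.Automorphic
  Summit.BirchSwinnertonDyer.Rank1Residual.X11b.AcSelmer

namespace Summit.BirchSwinnertonDyer.Rank1Residual.X11b

/-- **On X11b, (iv) fails only on the split / `p ∣ ord_p Δ_min` sub-shape**: for `(E, p) ∈` X11b with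
`p ≥ 5`, if the reduction at `p` is non-split, or `p ∤ ord_p(Δ_min)`, then `E(ℚ_p)[p] = 0` (sibling
sub-cell, `localTorsion_eq_zero_of_mult`). [cite: SilvermanAEC2009, VII.2 Prop. 2.1, VII.3 Prop. 3.1, Thm VII.6.1]
[cite: Castella2018Erratum, Thm. A′ and Remark (pp. 1–2)] -/
theorem localTorsion_eq_zero_of_classX11b {W : WeierstrassCurve ℚ} [W.IsElliptic]
    [W.IsGloballyMinimal] {p : ℕ} [Fact p.Prime] (hX : ClassX11b W p) (hp5 : 5 ≤ p)
    (h : ¬ W.HasSplitMultiplicativeReductionAtPrime p ∨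
      ¬ p ∣ padicValInt p W.minimalDiscriminantInt) :
    ∀ Q : (W.baseChange ℚ_[p]).toAffine.Point, p • Q = 0 → Q = 0 := by
  obtain ⟨-, -, hmult, -⟩ := hX
  exact LocalTorsion.localTorsion_eq_zero_of_mult W p (by omega) hmult h

/-- **THE STATEMENT OF RECORD, control input localised to the (T2α) sub-shape.**
`P2.bsdp_of_onTree_weakest` with its typed control input `P2ControlUpperOnTreeAt` (Cas18 Thm. 2.3 `≤`,
PUB shape) demanded ONLY at the pairs of X11b with SPLIT multiplicative reduction at `p` and
`p ∣ ord_p(Δ_min)` (the only pairs where (iv) `E(ℚ_p)[p] = 0` can fail, `localTorsion_eq_zero_of_classX11b`;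
= the (T2α) sub-shape, 20 824 class-wide pairs in the gen-9 census), and at the pairs with (iv) ONE
Selmer cardinality bound `P2SelmerCardBoundAt` ((d): the `≤` half of Cas18 (3.2.1)+(calcul), PUB
shape; the rest of the anticyclotomic control theorem — Greenberg's Lemmas incl. the Tamagawa bound,
the counting snake lemma, away descent — being kernel theorems). All other inputs unchanged: 14
published named facts; (T1ᵗ-IMC) `P2OpenInputOnTreeAt` — THE open input at `p ∥ N`; (T2α′); (T2♯-ℝ)
`P2ShimuraDisplaysAt`; (T3); (T4′). CONDITIONAL; nothing booked; reach and labels UNCHANGED.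
[cite: Castella2018, Thm. 2.3, (3.2.1) (arXiv:1704.06608 pp. 5–6), Thm. 3.2 (p. 9)]
[cite: Castella2018Erratum, Thm. 1.1 (iv), Thm. A′ and Remark] [cite: JetchevSkinnerWan2017, §7.4.1 and Prop. 3.2.1 (shape only)]
[cite: Wuthrich2014, Prop. 21 (p. 400)] [cite: Skinner2016PacificMC, Thm. C] -/
theorem P2.bsdp_of_onTree_weakest_alpha
    -- published inputs (named facts of the tree)
    (hGZ : ∀ (N : ℕ) [NeZero N] (W : WeierstrassCurve ℚ) (K : Type) [Field K] [NumberField K],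
      gross_zagier N W K)
    (hKo : ∀ (N : ℕ) [NeZero N] (W : WeierstrassCurve ℚ) (K : Type) [Field K] [NumberField K],
      kolyvagin N W K)
    (hB : ∀ (N : ℕ) [NeZero N] (W : WeierstrassCurve ℚ) (K : Type) [Field K] [NumberField K],
      Kolyvagin1990_padicValNat_card_sha_le N W K)
    (hSk : Skinner2016.thmC_padicValRat_bsd_rank_zero) (hWu : sha_dvd_analyticSha)
    (hGZK : rank_eq_analyticRank_of_analyticRank_le_one) (hmod : hasEntireLFunction_rat)
    (hnf : exists_isNewformOf) (hHL : HoffsteinLuo1997_exists_twist_L_one_ne_zero)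
    (hFHs : friedbergHoffstein_exists_heegnerField_split_twist_ne_zero)
    (hMaz : mazur_not_dvd_maninConstant_of_odd) (hNS : integral_neronScaling_of_isGloballyMinimal)
    (hBDMTV : thm12_not_le_normalizer_splitCartan)
    (hFH : friedbergHoffstein_exists_twist_ne_zero_inertAt)
    -- (T1ᵗ-CTL≤) PUB shape, ONLY on the (T2α) sub-shape (split at `p`, `p ∣ ord_p Δ_min`)
    (hC₀ : ∀ (W : WeierstrassCurve ℚ) [W.IsElliptic] [W.IsGloballyMinimal] (p : ℕ) [Fact p.Prime],
      W.HasSplitMultiplicativeReductionAtPrime p → p ∣ padicValInt p W.minimalDiscriminantInt →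
        P2ControlUpperOnTreeAt W p)
    -- (d) ONE Selmer bound (Cas18 (3.2.1) `≤`) at the pairs with (iv)
    (hC₁ : ∀ (W : WeierstrassCurve ℚ) [W.IsElliptic] [W.IsGloballyMinimal] (p : ℕ) [Fact p.Prime],
      (∀ Q : (W.baseChange ℚ_[p]).toAffine.Point, p • Q = 0 → Q = 0) → P2SelmerCardBoundAt W p)
    -- (T1ᵗ-IMC) THE open input
    (hA : ∀ (W : WeierstrassCurve ℚ) [W.IsElliptic] [W.IsGloballyMinimal] (p : ℕ) [Fact p.Prime],
      P2OpenInputOnTreeAt W p)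
    -- (T2α′)
    (hUα : ∀ (W : WeierstrassCurve ℚ) [W.IsElliptic] [W.IsGloballyMinimal] (p : ℕ) [Fact p.Prime],
      ClassX11b W p → 5 ≤ p → p ∣ W.tamagawaProduct →
      (¬ Ram W p ∨ (W.HasSplitMultiplicativeReductionAtPrime p ∧
        p ∣ padicValInt p W.minimalDiscriminantInt)) → Typed.MissingUpperBoundAt W p)
    -- (T2♯-ℝ) the Shimura displays, weakest form
    (hSh : ∀ (W : WeierstrassCurve ℚ) [W.IsElliptic] [W.IsGloballyMinimal] (p : ℕ) [Fact p.Prime],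
      ClassX11b W p → 5 ≤ p → P2ShimuraDisplaysAt W p)
    -- (T3)
    (hX11a : ∀ (Wd : WeierstrassCurve ℚ) [Wd.IsElliptic] [Wd.IsGloballyMinimal] (p : ℕ)
      [Fact p.Prime], ClassX11a Wd p → Typed.MissingLowerBoundAt Wd p)
    -- (T4′)
    (hCorner : ∀ (W : WeierstrassCurve ℚ) [W.IsElliptic] [W.IsGloballyMinimal] (p : ℕ)
      [Fact p.Prime], ClassX11b W p → ¬ Surj W p → (p = 5 ∨ p = 7) →
        p ∣ padicValInt p W.minimalDiscriminantInt → ¬ Ram W p → Typed.MissingPPartAt W p)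
    (W : WeierstrassCurve ℚ) [W.IsElliptic] [W.IsGloballyMinimal] (p : ℕ) [Fact p.Prime]
    (hX : ClassX11b W p) (hp5 : 5 ≤ p) : BSDp W p := by
  refine P2.bsdp_of_onTree_weakest_split hGZ hKo hB hSk hWu hGZK hmod hnf hHL hFHs hMaz hNS hBDMTV
    hFH ?_ hC₁ hA hUα hSh hX11a hCorner W p hX hp5
  -- (iv) fails ⟹ split at `p` and `p ∣ ord_p Δ_min` — available only inside the predicate's binders
  intro W _ _ p _ hniv N _ K _ _ Dt Hg ι P hX' hp5' hs hN hK hodd hpd hμ hHN hLt hP hc hPinf κ hκ γ _ 𝔭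
    h𝔭 he hf
  have hsplit : W.HasSplitMultiplicativeReductionAtPrime p := by
    by_contra hns
    exact hniv (localTorsion_eq_zero_of_classX11b hX' hp5' (Or.inl hns))
  have hdvd : p ∣ padicValInt p W.minimalDiscriminantInt := by
    by_contra hnd
    exact hniv (localTorsion_eq_zero_of_classX11b hX' hp5' (Or.inr hnd))
  exact hC₀ W p hsplit hdvd N K Dt Hg ι P hX' hp5' hs hN hK hodd hpd hμ hHN hLt hP hc hPinf κ hκ γ 𝔭
    h𝔭 he hf

end Summit.BirchSwinnertonDyer.Rank1Residual.X11b

end
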